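import Literature.AlgebraicGeometry.HodgeTheory.AtiyahPowers
import Literature.AlgebraicGeometry.Modules.TensorSheafHomIso
import Literature.AlgebraicGeometry.Modules.TensorBraiding
import Literature.AlgebraicGeometry.Modules.TensorUnitors
import Literature.AlgebraicGeometry.Modules.BoxTensorExactRight
import Literature.AlgebraicGeometry.Modules.InvertibleModule
import HarnessLib

/-!
# The obstruction class `ob_κ(E) = (id_E ⊗ κ) ∘ At(E) ∈ Ext²(E, E)` of a vector bundle along a first-order deformation
# of the base (Huybrechts–Thomas 2010, Main Theorem; Illusie), on real carriers

Layer `Literature/AlgebraicGeometry/HodgeTheory`, namespace `Literature.AlgebraicGeometry.HodgeTheory`. DEFINITION FILE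
(typer docket 2 of director-hodge req-200, item (F-BF) «Buchweitz–Flenner compatibility `σ ∘ ⟨κ, At⟩ = ⟨κ, ch⟩`», SOURCE
SIDE; cell `pub-hsemireg`, unit `lit-hodge-lemmaU-1` g1): two definitions WITH BODY and three API lemmas, no named fact, no
instance, no notation, no `sorry`. It supplies, on REAL carriers, the «Kodaira–Spencer ∕ contraction carrier» that the cell's
typed first-order model records as missing («the model-to-sheaf bridge (Buchweitz–Flenner 2003 Prop. 4.4 ∕ Cor. 4.3, the
Kodaira–Spencer ∕ contraction carrier) is NOT included», `Summits/Ventures/HSemireg/Pad4FirstOrderModel`, module docstring) and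
that memo-211 (evidence #55 on stmt-HodgeConjecture-18881) calls `ob_κ(𝓔) := κ ∪ At(𝓔) ∈ Ext²(𝓔, 𝓔)`, hypothesis (H2).

## Source, verbatim

[HuybrechtsThomas2010] D. Huybrechts, R. P. Thomas, *Deformation-obstruction theory for complexes via Atiyah and
Kodaira–Spencer classes*, Math. Ann. 346 (2010) (held: arXiv:0805.3527, p. 3 L76–101): «Suppose that `i : X₀ ↪ X` is a
square zero thickening of schemes […] defined by an ideal sheaf `I` on `X` with `I² = 0`. […] one can also define a truncated
Kodaira–Spencer class `κ(X₀/X) ∈ Ext¹_{X₀}(𝕃_{X₀}, I)` of the embedding `X₀ ⊂ X`. Given a perfect complex `E₀` over `X₀`,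
there is, as above, a truncated Atiyah class `A(E₀) ∈ Ext¹_{X₀}(E₀, E₀ ⊗ 𝕃_{X₀})`. The main result of this paper is that the
product of these classes is the obstruction to deforming the complex `E₀` over `X`. […] **Theorem.** Let `E₀` be a perfect
complex on a separated noetherian scheme `X₀` and let `i : X₀ ↪ X` be a closed embedding defined by an ideal `I` of square
zero. Assume that `X` can be embedded into a smooth (over `B`) ambient space `A`. Then there exists a perfect complex `E` on `X`
such that the derived pull-back `i^*E` is quasi-isomorphic to `E₀` if and only if
`0 = (id_{E₀} ⊗ κ(X₀/X)) ∘ A(E₀) ∈ Ext²_{X₀}(E₀, E₀ ⊗ I)`.»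

For `X₀ = X/S` with `Ω¹_{X/S}` finite locally free (e.g. smooth) the truncated cotangent complex is `Ω¹_{X/S}`, a FIRST-ORDER
deformation of `X` (over `S[ε]`, ideal `I = 𝒪_X`) has its Kodaira–Spencer class in `Ext¹_{𝒪_X}(Ω¹_{X/S}, 𝒪_X)`
(`= H¹(X, 𝒯_{X/S})`), and for a finite locally free `E` the truncated Atiyah class is the tree's torsion-safe Atiyah class
`atiyahClass' E ∈ Ext¹(E, 𝓗om(𝒯, E))` (`HodgeTheory/AtiyahClassCoherent`; `𝒯 = (Ω¹)^∨`, and `𝓗om(𝒯, E) ≅ E ⊗ Ω¹` for `Ω¹`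
finite locally free, [Hartshorne1977] II Ex. 5.1 (b) — the tree's `Modules.tensorSheafHomDualIso`).

## Contents

* `tangentHomTensorIso hΩ E : 𝓗om(𝒯_{X/S}, E) ≅ E ⊗ Ω¹_{X/S}` (`Modules.tensorSheafHomDualIso` and the symmetry
  `Modules.tensorComm`) — the identification of the two models of `E ⊗ Ω¹`;
* **`kodairaSpencerObstruction hΩ hE κ ∈ Ext²(E, E)`** for `κ ∈ Ext¹(Ω¹_{X/S}, 𝒪_X)` and `E` finite locally free: the Yoneda
  composite `E →At'(E) 𝓗om(𝒯, E)[1] ≅ (E ⊗ Ω¹)[1] →(E ⊗ κ)[1] (E ⊗ 𝒪_X)[2] ≅ E[2]`, where `E ⊗ κ` is the image of `κ` under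
  the EXACT functor `E ⊗ –` (`Modules.tensorBifunctor`; exact for `E` finite locally free: the tree's
  `preservesFiniteLimits_tensorBifunctor_obj_of_isFiniteLocallyFree`, `preservesFiniteColimits_tensorBifunctor_obj`; Mathlib's
  `Ext.mapExactFunctor`) — VERBATIM `(id_E ⊗ κ) ∘ A(E)`;
* `kodairaSpencerObstruction_def` (unfolding), `kodairaSpencerObstruction_zero` (`ob_0(E) = 0`), `kodairaSpencerObstruction_add`
  (`ob_{κ+κ'} = ob_κ + ob_κ'`: the obstruction is additive in the direction — `Ext.mapExactFunctor_add`, bilinearity of the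
  Yoneda product).

## What (F-BF) needs beyond this file (NOT typed here, with reasons — repair census)

(F-BF) is [BuchweitzFlenner2003] Prop. 4.2 ∕ Cor. 4.3 read in degree `2` (secondary held text [corpus: arXiv:2512.04114 p. 6
L44–64]): `σ_q(⟨κ, −At(E)⟩) = ⟨κ, ch_{q+1}(E)⟩` in `H^{q+2}(X, Ω^q)`, `σ_q` the tree's REAL `sigmaHigher hE q`
(`HodgeTheory/SemiregularityHigherSigma`). Its LEFT side now has a real carrier (`sigmaHigher hE q (kodairaSpencerObstruction hΩ hE κ)`).
Its RIGHT side needs (a) the Atiyah–Hodge Chern character `ch_{q+1}(E) = Tr(At(E)^{q+1})/(q+1)! ∈ H^{q+1}(X, Ω^{q+1})`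
(the tree has `At^q` — `atiyahPow`, `atiyahClassPower` — and the traces `traceCoeffToCohomology`, but no `ℚ`-structure on
`H^•(X, Ω^•)` for the factorial, cf. the normalisation note of `SemiregularityHigherSigma`), and (b) the contraction
`⟨κ, –⟩ : H^{q+1}(X, Ω^{q+1}) → H^{q+2}(X, Ω^q)` by `κ ∈ H¹(X, 𝒯)` (interior product `𝒯 ⊗ Ω^{q+1} → Ω^q` on the tree's
`Motives.hodgeSheaf X q = ⋀^q Ω¹` and its cup with `κ`) — the tree has the wedge `Ω^j → 𝓗om(Ω¹, Ω^{j+1})`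
(`HodgeTheory/HodgeSheafWedge`) but no interior product. With (a)–(b) typed, (F-BF) is ONE named fact on real carriers; it is
not stated here over posited maps (a `def … : Prop` quantified over an arbitrary contraction datum would be false on junk data,
cf. the design note of `HodgeTheory/TwistedSemiregularityMap`).

Naturality of `ob_κ` in `E` along module maps and along the connecting morphism of a short exact sequence — the other input of
memo-211 §2 — is the tree's `atiyahClass'_naturality` (`HodgeTheory/AtiyahClassCoherentNaturality`) and
`extClass_comp_atiyahClass'_eq_neg` (`HodgeTheory/AtiyahClassConnecting`), composed with the functoriality of `E ↦ E ⊗ κ`; it is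
not restated here. HONEST LABEL: nothing here bears on HC; HC NOT proved.

## References

* [HuybrechtsThomas2010] D. Huybrechts, R. P. Thomas, Math. Ann. 346 (2010) 545–569, Main Theorem (arXiv:0805.3527 p. 3).
* [BuchweitzFlenner2003] R.-O. Buchweitz, H. Flenner, Compositio Math. 137 (2003), §3 (Atiyah class), §4 Prop. 4.2, Cor. 4.3,
  Def. 4.1 (semiregularity map).
* [Hartshorne1977] R. Hartshorne, *Algebraic Geometry* (1977), II Ex. 5.1 (b) (`𝓗om(𝓔^∨, 𝓕) ≅ 𝓔 ⊗ 𝓕`), III §6 (Ext).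
-/

noncomputable section

open CategoryTheory CategoryTheory.Abelian AlgebraicGeometry Opposite TopologicalSpace Limits

namespace Literature.AlgebraicGeometry.HodgeTheory

open Literature.AlgebraicGeometry.Modules Literature.AlgebraicGeometry.Motives

universe w u

section Obstruction

variable {S : Type u} [CommRing S] {X : Over (Spec (CommRingCat.of S))}

/-- **`𝓗om(𝒯_{X/S}, E) ≅ E ⊗ Ω¹_{X/S}`** for `Ω¹_{X/S}` finite locally free (`𝒯 = (Ω¹)^∨`): the tree's
`Ω¹ ⊗ E ≅ 𝓗om((Ω¹)^∨, E)` (`Modules.tensorSheafHomDualIso`, «`𝓗om(𝓔, 𝓕) ≅ 𝓔^∨ ⊗ 𝓕` for `𝓔` locally free of finite rank»)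
followed by the symmetry `Ω¹ ⊗ E ≅ E ⊗ Ω¹` (`Modules.tensorComm`). It identifies the target `twistTangentHom E` of the
torsion-safe Atiyah class with Huybrechts–Thomas' `E ⊗ 𝕃_X` (`𝕃_X = Ω¹_{X/S}` here).
[cite: Hartshorne1977, II Ex. 5.1 (b) (p. 123)] [cite: HuybrechtsThomas2010, Main Theorem (arXiv p. 3)] -/
def tangentHomTensorIso (hΩ : IsFiniteLocallyFree (cotangentSheaf X)) (E : X.left.Modules) :
    twistTangentHom E ≅ tensorObj E (cotangentSheaf X) :=
  (tensorSheafHomDualIso (cotangentSheaf X) E hΩ).symm ≪≫ tensorComm (cotangentSheaf X) E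

variable [HasExt.{w} X.left.Modules]

/-- **The obstruction class `ob_κ(E) = (id_E ⊗ κ) ∘ At(E) ∈ Ext²(E, E)`** of a finite locally free `E` along a first-order
deformation of `X/S` with Kodaira–Spencer class `κ ∈ Ext¹(Ω¹_{X/S}, 𝒪_X)` («there exists a perfect complex `E` on `X` such
that `i^*E ≃ E₀` if and only if `0 = (id_{E₀} ⊗ κ(X₀/X)) ∘ A(E₀) ∈ Ext²_{X₀}(E₀, E₀ ⊗ I)`», here `I = 𝒪`): the Yoneda
composite of the torsion-safe Atiyah class `At'(E) ∈ Ext¹(E, 𝓗om(𝒯, E))`, the identification `𝓗om(𝒯, E) ≅ E ⊗ Ω¹`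
(`tangentHomTensorIso`), the class `E ⊗ κ ∈ Ext¹(E ⊗ Ω¹, E ⊗ 𝒪_X)` (image of `κ` under the exact functor `E ⊗ –`, Mathlib
`Ext.mapExactFunctor`), and the unitor `E ⊗ 𝒪_X ≅ E`. Memo-211's `ob_κ(𝓔) = κ ∪ At(𝓔)`.
[cite: HuybrechtsThomas2010, Main Theorem (arXiv p. 3, L89–101)] [cite: BuchweitzFlenner2003, §3 (Atiyah class)] -/
def kodairaSpencerObstruction (hΩ : IsFiniteLocallyFree (cotangentSheaf X)) {E : X.left.Modules}
    (hE : IsFiniteLocallyFree E) (κ : Ext.{w} (cotangentSheaf X) (unitModule X.left) 1) : Ext.{w} E E 2 :=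
  letI : ((tensorBifunctor X.left).obj E).Additive := additive_tensorBifunctor_obj E
  letI : PreservesFiniteLimits ((tensorBifunctor X.left).obj E) :=
    preservesFiniteLimits_tensorBifunctor_obj_of_isFiniteLocallyFree hE
  letI : PreservesFiniteColimits ((tensorBifunctor X.left).obj E) := preservesFiniteColimits_tensorBifunctor_obj E
  (((atiyahClass'.{w} E).comp (Ext.mk₀ (tangentHomTensorIso hΩ E).hom) (add_zero 1)).comp
    (κ.mapExactFunctor ((tensorBifunctor X.left).obj E) :
      Ext.{w} (tensorObj E (cotangentSheaf X)) (tensorObj E (unitModule X.left)) 1) (rfl : 1 + 1 = 2)).comp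
    (Ext.mk₀ (tensorUnitRightIso E).hom) (add_zero 2)

variable (hΩ : IsFiniteLocallyFree (cotangentSheaf X)) {E : X.left.Modules} (hE : IsFiniteLocallyFree E)

/-- Unfolding of `kodairaSpencerObstruction` as the three-fold Yoneda composite `At'(E) · (≅) · (E ⊗ κ) · (unitor)`.
[cite: HuybrechtsThomas2010, Main Theorem (arXiv p. 3)] -/
theorem kodairaSpencerObstruction_def (κ : Ext.{w} (cotangentSheaf X) (unitModule X.left) 1) :
    kodairaSpencerObstruction hΩ hE κ =
      letI : ((tensorBifunctor X.left).obj E).Additive := additive_tensorBifunctor_obj E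
      letI : PreservesFiniteLimits ((tensorBifunctor X.left).obj E) :=
        preservesFiniteLimits_tensorBifunctor_obj_of_isFiniteLocallyFree hE
      letI : PreservesFiniteColimits ((tensorBifunctor X.left).obj E) := preservesFiniteColimits_tensorBifunctor_obj E
      (((atiyahClass'.{w} E).comp (Ext.mk₀ (tangentHomTensorIso hΩ E).hom) (add_zero 1)).comp
        (κ.mapExactFunctor ((tensorBifunctor X.left).obj E) :
          Ext.{w} (tensorObj E (cotangentSheaf X)) (tensorObj E (unitModule X.left)) 1) (rfl : 1 + 1 = 2)).comp
        (Ext.mk₀ (tensorUnitRightIso E).hom) (add_zero 2) :=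
  rfl

/-- **The trivial deformation is unobstructed**: `ob_0(E) = 0` (`E ⊗ 0 = 0`, and the Yoneda product is bilinear).
[cite: HuybrechtsThomas2010, Main Theorem (arXiv p. 3)] -/
theorem kodairaSpencerObstruction_zero : kodairaSpencerObstruction hΩ hE 0 = 0 := by
  letI : ((tensorBifunctor X.left).obj E).Additive := additive_tensorBifunctor_obj E
  letI : PreservesFiniteLimits ((tensorBifunctor X.left).obj E) :=
    preservesFiniteLimits_tensorBifunctor_obj_of_isFiniteLocallyFree hE
  letI : PreservesFiniteColimits ((tensorBifunctor X.left).obj E) := preservesFiniteColimits_tensorBifunctor_obj E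
  rw [kodairaSpencerObstruction_def, Ext.mapExactFunctor_zero]
  -- the middle factor is `0`; conclude by bilinearity (term-mode: the objects `(E ⊗ –).obj _` are definitionally,
  -- not syntactically, the `tensorObj E _`)
  exact (congrArg (fun t => Ext.comp t (Ext.mk₀ (tensorUnitRightIso E).hom) (add_zero 2))
    (Ext.comp_zero ((atiyahClass'.{w} E).comp (Ext.mk₀ (tangentHomTensorIso hΩ E).hom) (add_zero 1))
      (tensorObj E (unitModule X.left)) 1 2 rfl)).trans (Ext.zero_comp E 2 (Ext.mk₀ (tensorUnitRightIso E).hom) 2 (add_zero 2))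

/-- **The obstruction is additive in the deformation direction**: `ob_{κ + κ'}(E) = ob_κ(E) + ob_{κ'}(E)` (`E ⊗ –` is additive
on `Ext`, `Ext.mapExactFunctor_add`, and the Yoneda product is bilinear). So `κ ↦ ob_κ(E)` is a homomorphism
`Ext¹(Ω¹, 𝒪) → Ext²(E, E)` — memo-211's linear systems in `κ ∈ T_W`. [cite: HuybrechtsThomas2010, Main Theorem (arXiv p. 3)]
[cite: BuchweitzFlenner2003, §4 (the bimodule structure)] -/
theorem kodairaSpencerObstruction_add (κ κ' : Ext.{w} (cotangentSheaf X) (unitModule X.left) 1) :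
    kodairaSpencerObstruction hΩ hE (κ + κ') =
      kodairaSpencerObstruction hΩ hE κ + kodairaSpencerObstruction hΩ hE κ' := by
  letI : ((tensorBifunctor X.left).obj E).Additive := additive_tensorBifunctor_obj E
  letI : PreservesFiniteLimits ((tensorBifunctor X.left).obj E) :=
    preservesFiniteLimits_tensorBifunctor_obj_of_isFiniteLocallyFree hE
  letI : PreservesFiniteColimits ((tensorBifunctor X.left).obj E) := preservesFiniteColimits_tensorBifunctor_obj E
  rw [kodairaSpencerObstruction_def, kodairaSpencerObstruction_def, kodairaSpencerObstruction_def,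
    Ext.mapExactFunctor_add]
  exact (congrArg (fun t => Ext.comp t (Ext.mk₀ (tensorUnitRightIso E).hom) (add_zero 2))
    (Ext.comp_add ((atiyahClass'.{w} E).comp (Ext.mk₀ (tangentHomTensorIso hΩ E).hom) (add_zero 1))
      (κ.mapExactFunctor ((tensorBifunctor X.left).obj E) :
        Ext.{w} (tensorObj E (cotangentSheaf X)) (tensorObj E (unitModule X.left)) 1)
      (κ'.mapExactFunctor ((tensorBifunctor X.left).obj E) :
        Ext.{w} (tensorObj E (cotangentSheaf X)) (tensorObj E (unitModule X.left)) 1) rfl)).trans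
    (Ext.add_comp _ _ _ (add_zero 2))

end Obstruction

end Literature.AlgebraicGeometry.HodgeTheory

end
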